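import Literature.NumberTheory.DiophantineGeometry.Matveev2000LinearFormsLogNumberField
import Mathlib.Analysis.SpecialFunctions.Complex.LogBounds
import HarnessLib

/-!
# Matveev's bound in the `Λ`-form of the modular-method literature:
# Bugeaud–Mignotte–Siksek 2006, Theorem 9.4, and Gherga–Siksek 2025, Theorem 2 — GENERAL number
# field, PROVED from Matveev 2000 Cor. 2.3

Topic `NumberTheory/DiophantineGeometry`; namespace `Literature.NumberTheory.DiophantineGeometry.Dioph`.
Theorems only (no definitions, no new named facts; net debt 0). Input: the named fact
`matveev2000_linearFormsLog_nf` (= Matveev 2000, Cor. 2.3 = Evertse–Győry 2015, Thm. 3.2.4, general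
number field; `Matveev2000LinearFormsLogNumberField.lean`) through its PROVED "`B` may be replaced by
`max |bᵢ|`" form `matveev2000_linearFormsLog_nf_bstar`. Companion of
`Matveev2000LambdaFormNumberField.lean` (Evertse–Győry Thm. 3.2.5 / Koymans L. 3.6, the `Λ`-forms
with `A'ᵢ ≥ max{dh(αᵢ), π}` resp. `A'ᵢ = dh(αᵢ) + π`); the form proved here is the one with Matveev's
own `Aⱼ ≥ max{D h(αⱼ), |log αⱼ|, 0.16}` — the statement quoted as "Matveev's theorem" throughout the
modular-method / Lucas-sequence / Thue–Mahler literature.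

Source 1 (READ: arXiv:math/0403046 = Annals 163 (2006) 969–1018, §9.1, `lit read
arxiv:math/0403046`, chunk p0014): Y. Bugeaud, M. Mignotte, S. Siksek, *Classical and modular
approaches to exponential Diophantine equations I. Fibonacci and Lucas perfect powers*. "Let `𝕃` be
a number field of degree `D`, let `α₁,…,αₙ` be non-zero elements of `𝕃` and `b₁,…,bₙ` be rational
integers. Set `B = max{|b₁|,…,|bₙ|}`, and `Λ = α₁^{b₁}⋯αₙ^{bₙ} − 1`. Let `h` denote the absolute
logarithmic height and let `A₁,…,Aₙ` be real numbers with
`Aⱼ ≥ h'(αⱼ) := max{D h(αⱼ), |log αⱼ|, 0.16}`, `1 ≤ j ≤ n`. We call `h'` the modified height (with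
respect to the field `𝕃`). With this notation, the main result of Matveev [Mat] implies the
following estimate. **Theorem 9.4.** Assume that `Λ` is non-zero. We then have
`log|Λ| > −3·30^{n+4} (n+1)^{5.5} D² (1 + log D) (1 + log nB) A₁⋯Aₙ`.
Furthermore, if `𝕃` is real, we have
`log|Λ| > −1.4·30^{n+3} n^{4.5} D² (1 + log D) (1 + log B) A₁⋯Aₙ`.
*Proof.* Denote by `log` the principal determination of the logarithm. If `|Λ| < 1/3`, then there
exists an integer `b₀`, with `|b₀| ≤ nB`, such that `Ω := |b₀ log(−1) + b₁ log α₁ + ⋯ + bₙ log αₙ|`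
satisfies `|Λ| ≥ Ω/2`. Noticing that `h'(−1) = π`, and that `b₀ = 0` if `𝕃` is real, we deduce our
lower bounds from Corollary 2.3 of Matveev [Mat]."

Source 2 (READ: arXiv:2207.14492 = Algebra & Number Theory 19 (2025) 667–714, §5.2, `lit read
paper:arxiv-2207.14492`, chunks p0013–p0014): A. Gherga, S. Siksek, *Efficient resolution of
Thue–Mahler equations*. "Let `h'ⱼ = √(h(αⱼ)² + π²/D²)`, `j = 1,…,n`. The following theorem is a
version of Matveev's bound for linear forms in logarithms [Matveev]. **Theorem 2 (Matveev).** Let `ν`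
be an infinite place of `L`. Suppose `Λ ≠ 0`. Let
`c₅(n,D,α₁,…,αₙ) = 6·30^{n+4}·(n+1)^{5.5}·D^{n+2}·log(eD)·h'₁⋯h'ₙ`. Then
`log ‖Λ⁻¹‖_ν ≤ c₅(n,D,α₁,…,αₙ)·(log(en) + log B)`. *Proof.* … Theorem 9.4 of [BMS1] … Since
`‖Λ‖ = |Λ|^{D_ν}`, where `D_ν` is either `1` or `2` … it is sufficient to show that
`h''ⱼ ≤ D h'ⱼ` … `|log(σ(αⱼ))| ≤ √(D²·h(αⱼ)² + π²) = D·h'ⱼ`." (`‖·‖_ν := |·|_ν^{D_ν}`,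
`|α|_ν = |σ(α)|`, §5.)

## How the printed proofs are mirrored (and where Mathlib / the typed fact forces detail)

* `|Λ| = ‖σ(∏ αₖ^{bₖ}) − 1‖` for the embedding `σ : K →+* ℂ` ("`𝕃 ⊂ ℂ`"); `log αⱼ` = Mathlib's
  principal `Complex.log (σ αⱼ)`; `D h(αⱼ)` = Mathlib's `Height.logHeight₁ (αⱼ)` on `K` (which is
  `D·h`, Evertse–Győry §1.9 normalisation = Mathlib's); `B` typed as `B ≥ max |bⱼ|` (the bounds are
  monotone in `B`; `B ≥ 1` follows from `Λ ≠ 0`).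
* "we may assume `|Λ| < 1/3`": here `|Λ| ≤ ½` (else `log|Λ| > −log 2`, far inside the bound);
  `Σ := ∑ bₖ log αₖ`, `b₀ := −2·round(Im Σ/2π)`, `Σ' := b₀·πi + Σ = log(1+Λ)` (principal),
  `‖Σ'‖ ≤ (3/2)|Λ|` (Mathlib `Complex.norm_log_one_add_half_le_self`), so `|Λ| ≥ Ω/2` with `Ω = ‖Σ'‖`;
  "`|b₀| ≤ nB`": `|πb₀| ≤ |Im Σ| + |Im Σ'| ≤ nB₁π + ¾` with `B₁ = max|bₖ| ∈ ℕ`, hence `|b₀| ≤ nB₁`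
  (integrality).
* Cor. 2.3 is typed for `n ≥ 2` non-zero logarithms: the COMPLEX clause feeds it the `|S| + 1 ≥ 2`
  numbers `(−1; αₖ, k ∈ S)`, `S = {k : αₖ ≠ 1}` (an `αₖ = 1` has `log αₖ = 0` and is dropped — its
  `Aₖ ≥ 0.16` and the factor `30` of the constant per index cover the drop: `30·0.16 ≥ 1`), with
  `A₀ = h'(−1) = π` and `ϰ = 2`: `π·(1/2)(e(n+1)/2)²·30^{n+4}(n+1)^{3.5} = (πe²/8)·30^{n+4}(n+1)^{5.5}`,
  `πe²/8 = 2.9018… < 3`, the slack absorbing `log 2`. So the complex clause is PROVED AS PRINTED (for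
  every `n ≥ 1`; `n = 0` is excluded by `Λ ≠ 0`).
* REAL clause ("`b₀ = 0` if `𝕃` is real", `ϰ = 1`: `(e n/2)·30^{n+3} n^{3.5} = (e/2)·30^{n+3}n^{4.5}`,
  `e/2 = 1.359… < 1.4`): for `σ(K) ⊂ ℝ` one works with the REAL logarithms `log|σ αₖ|` of `±αₖ`
  (same heights, `|log|σαₖ|| ≤ |log σαₖ|`), for which `∑ bₖ log|σαₖ| = log|1+Λ|` exactly (no `b₀`;
  `1 + Λ < 0` forces `|Λ| > 1`). The printed "`b₀ = 0`" silently needs these real logarithms to be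
  NON-ZERO and at least two in number (Cor. 2.3: `n ≥ 2`, `log αⱼ ≠ 0`): the clause is typed under
  the extra hypotheses `n ≥ 2` and `αₖ ≠ ±1` for all `k` — WEAKER than print by exactly these
  hypotheses (the residual configurations, e.g. `n = 2`, `α₂ = 1`, are one-logarithm bounds, true by
  the `n = 1` theory but not derivable from the typed `n ≥ 2` fact with the constant `1.4`; recorded,
  not hidden).
* Gherga–Siksek Thm. 2: the complex clause at `σ = w.embedding`, `Aⱼ := √(logHeight₁(αⱼ)² + π²) =
  D h'ⱼ` (`|Re log σαⱼ| = |log|σαⱼ|| ≤ D h(αⱼ)` by Liouville's inequality at `σ`, `|Im| ≤ π`),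
  `‖x‖_ν = w(x)^{mult w}`, `mult w ∈ {1,2}`, `1 + log(nB) = log(en) + log B`,
  `D^{n+2} ∏ h'ⱼ = D² ∏ (D h'ⱼ)`. PROVED AS PRINTED (for every `n`; `B ≥ max|bⱼ|`).

FAITHFULNESS SHEET: `bugeaudMignotteSiksek2006_thm_9_4_nf_of_matveev` (complex clause) FAITHFUL;
`bugeaudMignotteSiksek2006_thm_9_4_real_nf_of_matveev` WEAKER (extra hypotheses `n ≥ 2`, `αₖ ≠ ±1`);
`ghergaSiksek2025_thm2_nf_of_matveev` FAITHFUL (strict `<` for the printed `≤`). Net debt 0.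
WHAT THIS IS NOT: nothing of Matveev's theorem is proved here (the input is the named fact); not an
abc statement; typed ≠ proved ≠ endorsed.

## References

* [BugeaudMignotteSiksek2006] Y. Bugeaud, M. Mignotte, S. Siksek, Classical and modular approaches to
  exponential Diophantine equations I. Fibonacci and Lucas perfect powers, Ann. of Math. 163 (2006)
  969–1018: §9.1, Theorem 9.4 with its proof (arXiv:math/0403046).
* [GhergaSiksek2025] A. Gherga, S. Siksek, Efficient resolution of Thue–Mahler equations, Algebra &
  Number Theory 19 (2025) 667–714: §5.2, Theorem 2 ("Matveev") with its proof (arXiv:2207.14492).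
* [Matveev2000] E. M. Matveev, Izv. Math. 64 (2000) 1217–1269: Corollary 2.3.
* [EvertseGyory2015] J.-H. Evertse, K. Győry, Unit Equations in Diophantine Number Theory, CUP 2015:
  Thm. 3.2.4 (p. 61) (= Matveev Cor. 2.3, the typed input).
-/

open Height Real Finset NumberField

noncomputable section

namespace Literature.NumberTheory.DiophantineGeometry.Dioph

/-! #### Liouville's inequality at an archimedean place -/

/-- `‖σ x‖ ≤ H_K(x)` for an embedding `σ : K →+* ℂ` of a number field. [folklore] -/
private theorem bms_norm_embedding_le_mulHeight₁ {K : Type*} [Field K] [NumberField K]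
    (σ : K →+* ℂ) (x : K) : ‖σ x‖ ≤ mulHeight₁ x := by
  classical
  rw [NumberField.mulHeight₁_eq, ← NumberField.InfinitePlace.apply σ x]
  set w : NumberField.InfinitePlace K := NumberField.InfinitePlace.mk σ with hw
  set F : NumberField.InfinitePlace K → ℝ := fun v => max (v x) 1 ^ v.mult with hF
  have hF1 : ∀ v, 1 ≤ F v := fun v => one_le_pow₀ (le_max_right _ _)
  have h1 : w x ≤ F w :=
    (le_max_left _ _).trans (le_self_pow₀ (le_max_right _ _) NumberField.InfinitePlace.mult_ne_zero)
  have h2 : F w ≤ ∏ v : NumberField.InfinitePlace K, F v := by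
    rw [← Finset.mul_prod_erase Finset.univ F (Finset.mem_univ w)]
    exact le_mul_of_one_le_right (zero_le_one.trans (hF1 w))
      (Finset.one_le_prod fun v _ => hF1 v)
  have h3 : (1 : ℝ) ≤ ∏ᶠ v : NumberField.FinitePlace K, max (v x) 1 :=
    one_le_finprod fun v => le_max_right _ _
  calc w x ≤ ∏ v : NumberField.InfinitePlace K, F v := h1.trans h2
    _ = (∏ v : NumberField.InfinitePlace K, F v) * 1 := (mul_one _).symm
    _ ≤ (∏ v : NumberField.InfinitePlace K, F v) *
          ∏ᶠ v : NumberField.FinitePlace K, max (v x) 1 :=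
        mul_le_mul_of_nonneg_left h3 (Finset.prod_nonneg fun v _ => (zero_le_one.trans (hF1 v)))

/-- `|log ‖σ x‖| ≤ log H_K(x) = D h(x)` for `x ≠ 0` ("`log|σ(αⱼ)| ≤ D·h(αⱼ)`", Gherga–Siksek (5.?)
`log ‖α‖_ν ≤ [L:ℚ]·h(α)` applied to `α` and `α⁻¹`). [cite: GhergaSiksek2025, §5 Lemma 5.2 (last display)] -/
private theorem bms_abs_log_norm_le_logHeight₁ {K : Type*} [Field K] [NumberField K]
    (σ : K →+* ℂ) {x : K} (hx : x ≠ 0) : |Real.log ‖σ x‖| ≤ logHeight₁ x := by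
  have hσx : 0 < ‖σ x‖ := norm_pos_iff.mpr ((map_ne_zero σ).mpr hx)
  rw [abs_le]
  constructor
  · have h := bms_norm_embedding_le_mulHeight₁ σ x⁻¹
    rw [map_inv₀, norm_inv, mulHeight₁_inv] at h
    rw [logHeight₁_eq_log_mulHeight₁, neg_le, ← Real.log_inv]
    exact Real.log_le_log (inv_pos.mpr hσx) h
  · rw [logHeight₁_eq_log_mulHeight₁]
    exact Real.log_le_log hσx (bms_norm_embedding_le_mulHeight₁ σ x)

/-- `‖log z‖ ≤ √(a² + π²)` whenever `|log ‖z‖| ≤ a` (principal logarithm: `|Im log z| ≤ π`).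
[cite: GhergaSiksek2025, §5.2 proof of Theorem 2 (last display)] -/
private theorem bms_norm_log_le_sqrt {z : ℂ} {a : ℝ} (hre : |Real.log ‖z‖| ≤ a) :
    ‖Complex.log z‖ ≤ Real.sqrt (a ^ 2 + Real.pi ^ 2) := by
  have ha : 0 ≤ a := le_trans (abs_nonneg _) hre
  have him : |(Complex.log z).im| ≤ Real.pi := by
    rw [Complex.log_im]; exact Complex.abs_arg_le_pi z
  have hre' : |(Complex.log z).re| ≤ a := by rw [Complex.log_re]; exact hre
  rw [Real.le_sqrt (norm_nonneg _) (by positivity), Complex.sq_norm, Complex.normSq_apply]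
  have h1 : (Complex.log z).re * (Complex.log z).re ≤ a * a := by
    rw [← abs_mul_abs_self]; exact mul_le_mul hre' hre' (abs_nonneg _) ha
  have h3 : (Complex.log z).im * (Complex.log z).im ≤ Real.pi * Real.pi := by
    rw [← abs_mul_abs_self]; exact mul_le_mul him him (abs_nonneg _) Real.pi_pos.le
  nlinarith

/-! #### Numerical constants -/

/-- `π e²/8 < 2.902` (`= 2.9018…`): Matveev's `(1/2)(e(n+1)/2)²` times `A₀ = π` against the printed
`3`. [cite: BugeaudMignotteSiksek2006, Theorem 9.4 (the constant 3)] -/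
private theorem bms_pi_mul_exp_sq_lt : Real.pi * Real.exp 1 ^ 2 / 8 < 2902 / 1000 := by
  have hE2 := Real.exp_one_lt_d9
  have hE0 : 0 < Real.exp 1 := Real.exp_pos 1
  have hπ := Real.pi_lt_d6
  have hEsq : Real.exp 1 ^ 2 < 7389057 / 1000000 := by nlinarith
  nlinarith [Real.pi_pos]

/-- `e/2 < 1.3592` (`= 1.35914…`): Matveev's `e n/2` (`ϰ = 1`) against the printed `1.4`.
[cite: BugeaudMignotteSiksek2006, Theorem 9.4 (the constant 1.4)] -/
private theorem bms_exp_div_two_lt : Real.exp 1 / 2 < 13592 / 10000 := by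
  have hE2 := Real.exp_one_lt_d9
  linarith

/-- `30^{#ι} · ∏_{ι} A ≥ 1` when every `Aᵢ ≥ 0.16` (`30 · 0.16 = 4.8 ≥ 1`): the cost of dropping the
indices with `αₖ = 1`. [folklore] -/
private theorem bms_one_le_pow_mul_prod {ι : Type*} [Fintype ι] (A : ι → ℝ)
    (hA : ∀ i, (0.16 : ℝ) ≤ A i) : (1 : ℝ) ≤ 30 ^ Fintype.card ι * ∏ i, A i := by
  have h : (30 : ℝ) ^ Fintype.card ι * ∏ i, A i = ∏ i, (30 * A i) := by
    rw [Finset.prod_mul_distrib, Finset.prod_const, Finset.card_univ]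
  rw [h]
  exact Finset.one_le_prod fun i _ => by linarith [hA i]

/-! #### Bugeaud–Mignotte–Siksek 2006, Theorem 9.4 — the complex clause (as printed) -/

/-- **Bugeaud–Mignotte–Siksek 2006 (Ann. of Math. 163), Theorem 9.4, first clause, GENERAL number
field, PROVED AS PRINTED from Matveev's Cor. 2.3 (`matveev2000_linearFormsLog_nf`).** Let `K` be a
number field of degree `D`, `σ : K →+* ℂ` an embedding (`|·| := |σ(·)|`), `α₁,…,αₙ ∈ K*` (indexed by
a finite type `κ`), `b ∈ ℤⁿ`, `Λ = α₁^{b₁}⋯αₙ^{bₙ} − 1 ≠ 0`, `B ≥ max |bⱼ|` (print: `B = max |bⱼ|`;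
the bound is monotone in `B`), and reals `Aⱼ ≥ h'(αⱼ) = max{D h(αⱼ), |log αⱼ|, 0.16}` (`log` the
principal determination, `D h` = Mathlib's `logHeight₁` on `K`). Then
`log|Λ| > −3·30^{n+4}·(n+1)^{5.5}·D²·(1 + log D)·(1 + log nB)·A₁⋯Aₙ`.
Proof as printed (module docstring): `|Λ| ≥ ½|b₀ log(−1) + Σ bⱼ log αⱼ|` with `|b₀| ≤ nB`,
`h'(−1) = π`, Cor. 2.3 with `ϰ = 2` for the numbers `(−1; αⱼ with αⱼ ≠ 1)`; `πe²/8 < 3`.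
FAITHFUL. WHAT THIS IS NOT: nothing of Matveev is proved; typed ≠ proved ≠ endorsed.
[cite: BugeaudMignotteSiksek2006, Theorem 9.4 (first clause) with proof, §9.1]
[cite: Matveev2000, Corollary 2.3] [cite: EvertseGyory2015, Thm 3.2.4 (p. 61)] -/
theorem bugeaudMignotteSiksek2006_thm_9_4_nf_of_matveev (h : matveev2000_linearFormsLog_nf) :
    ∀ (K : Type) [Field K] [NumberField K] (σ : K →+* ℂ) (κ : Type) [Fintype κ]
      (α : κ → K) (b : κ → ℤ) (A : κ → ℝ) (B : ℝ),
      (∀ k, α k ≠ 0) → ∏ k, α k ^ b k ≠ 1 →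
      (∀ k, (|b k| : ℝ) ≤ B) →
      (∀ k, max (logHeight₁ (α k)) (max ‖Complex.log (σ (α k))‖ 0.16) ≤ A k) →
      -(3 * 30 ^ (Fintype.card κ + 4) * ((Fintype.card κ : ℝ) + 1) ^ (11 / 2 : ℝ) *
          ((Module.finrank ℚ K : ℝ) ^ 2 * (1 + Real.log (Module.finrank ℚ K))) *
          (1 + Real.log (Fintype.card κ * B)) * ∏ k, A k) <
        Real.log ‖σ (∏ k, α k ^ b k) - 1‖ := by
  intro K _ _ σ κ _ α b A B hα hΛ hbB hA
  classical
  set n : ℕ := Fintype.card κ with hndef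
  set D : ℕ := Module.finrank ℚ K with hDdef
  set E : ℝ := Real.exp 1 with hEdef
  have hE0 : 0 < E := Real.exp_pos 1
  have hπ3 : 3 < Real.pi := Real.pi_gt_three
  have hπ4 : Real.pi < 4 := Real.pi_lt_four
  have hπ0 : 0 < Real.pi := Real.pi_pos
  have hD0 : 0 < D := Module.finrank_pos
  have hD1 : (1 : ℝ) ≤ D := by exact_mod_cast hD0
  -- the data `A`
  have hA16 : ∀ k, (0.16 : ℝ) ≤ A k := fun k =>
    le_trans (le_max_right _ _) (le_trans (le_max_right _ _) (hA k))
  have hApos : ∀ k, 0 < A k := fun k => lt_of_lt_of_le (by norm_num) (hA16 k)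
  have hAl : ∀ k, ‖Complex.log (σ (α k))‖ ≤ A k := fun k =>
    le_trans (le_max_left _ _) (le_trans (le_max_right _ _) (hA k))
  -- `θ = ∏ αₖ^{bₖ} ≠ 1`: some `bₖ ≠ 0`, some `αₖ ≠ 1`, `n ≥ 1`
  set θ : K := ∏ k, α k ^ b k with hθ
  have hb0 : ∃ k, b k ≠ 0 := by
    by_contra hall
    push Not at hall
    exact hΛ (by simp [hθ, hall])
  obtain ⟨k₁, hk₁⟩ := hb0
  have hα1 : ∃ k, α k ≠ 1 := by
    by_contra hall
    push Not at hall
    exact hΛ (by simp [hθ, hall])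
  have hn1 : 1 ≤ n := Fintype.card_pos_iff.mpr ⟨k₁⟩
  have hn1r : (1 : ℝ) ≤ n := by exact_mod_cast hn1
  -- `B₁ = max |bₖ| ∈ ℕ`, `1 ≤ B₁ ≤ B`
  set B₁ : ℕ := Finset.univ.sup fun k => (b k).natAbs with hB₁def
  have hbB₁ : ∀ k, (b k).natAbs ≤ B₁ := fun k =>
    Finset.le_sup (f := fun k => (b k).natAbs) (Finset.mem_univ k)
  have hbB₁r : ∀ k, |(b k : ℝ)| ≤ (B₁ : ℝ) := fun k => by
    rw [← Int.cast_abs, Int.abs_eq_natAbs]; exact_mod_cast hbB₁ k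
  have hB₁1 : 1 ≤ B₁ := le_trans (Int.natAbs_pos.mpr hk₁) (hbB₁ k₁)
  have hB₁1r : (1 : ℝ) ≤ B₁ := by exact_mod_cast hB₁1
  obtain ⟨k₂, -, hk₂⟩ := Finset.exists_mem_eq_sup (Finset.univ : Finset κ)
    (Finset.univ_nonempty_iff.mpr ⟨k₁⟩) (fun k => (b k).natAbs)
  have hB₁B : (B₁ : ℝ) ≤ B := by
    have h1 : |(b k₂ : ℝ)| = ((b k₂).natAbs : ℝ) := by
      rw [← Int.cast_abs, Int.abs_eq_natAbs, Int.cast_natCast]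
    rw [hB₁def, hk₂, ← h1]; exact hbB k₂
  have hB1 : (1 : ℝ) ≤ B := hB₁1r.trans hB₁B
  have hB0 : 0 < B := by linarith
  -- `LD2 = D²(1 + log D) ≥ 1`, `L = 1 + log(nB) ≥ 1`, `Ω = ∏ A`, `X`
  set LD2 : ℝ := (D : ℝ) ^ 2 * (1 + Real.log D) with hLD2def
  have hlogD0 : 0 ≤ Real.log D := Real.log_nonneg hD1
  have hLD2 : 1 ≤ LD2 := one_le_mul_of_one_le_of_one_le (one_le_pow₀ hD1) (by linarith)
  set L : ℝ := 1 + Real.log (n * B) with hLdef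
  have hnB1 : (1 : ℝ) ≤ n * B := one_le_mul_of_one_le_of_one_le hn1r hB1
  have hL1 : 1 ≤ L := by have := Real.log_nonneg hnB1; rw [hLdef]; linarith
  set Ω : ℝ := ∏ k, A k with hΩdef
  have hΩ0 : 0 < Ω := Finset.prod_pos fun k _ => hApos k
  have h30Ω : (1 : ℝ) ≤ 30 ^ n * Ω := bms_one_le_pow_mul_prod A hA16
  have hn55 : (1 : ℝ) ≤ ((n : ℝ) + 1) ^ (11 / 2 : ℝ) := Real.one_le_rpow (by linarith) (by norm_num)
  set X : ℝ := 30 ^ (n + 4) * ((n : ℝ) + 1) ^ (11 / 2 : ℝ) * LD2 * L * Ω with hXdef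
  have hX1 : (30 : ℝ) ^ 4 ≤ X := by
    have h1 : X = 30 ^ 4 * ((30 ^ n * Ω) * (((n : ℝ) + 1) ^ (11 / 2 : ℝ) * (LD2 * L))) := by
      rw [hXdef, pow_add]; ring
    rw [h1]
    have h2 : (1 : ℝ) ≤ LD2 * L := one_le_mul_of_one_le_of_one_le hLD2 hL1
    have h3 : (1 : ℝ) ≤ ((n : ℝ) + 1) ^ (11 / 2 : ℝ) * (LD2 * L) :=
      one_le_mul_of_one_le_of_one_le hn55 h2
    have h4 : (1 : ℝ) ≤ (30 ^ n * Ω) * (((n : ℝ) + 1) ^ (11 / 2 : ℝ) * (LD2 * L)) :=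
      one_le_mul_of_one_le_of_one_le h30Ω h3
    calc (30 : ℝ) ^ 4 = 30 ^ 4 * 1 := (mul_one _).symm
      _ ≤ 30 ^ 4 * ((30 ^ n * Ω) * (((n : ℝ) + 1) ^ (11 / 2 : ℝ) * (LD2 * L))) :=
          mul_le_mul_of_nonneg_left h4 (by norm_num)
  have hgoal : 3 * 30 ^ (n + 4) * ((n : ℝ) + 1) ^ (11 / 2 : ℝ) * LD2 * L * Ω = 3 * X := by
    rw [hXdef]; ring
  rw [hgoal]
  -- `Λ = σ θ − 1 ≠ 0`
  have hσθ1 : σ θ - 1 ≠ 0 := by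
    rw [← map_one σ, ← map_sub]; exact (map_ne_zero σ).mpr (sub_ne_zero.mpr hΛ)
  have hw0 : 0 < ‖σ θ - 1‖ := norm_pos_iff.mpr hσθ1
  have hlog2 : 0 < Real.log 2 := Real.log_pos (by norm_num)
  have hlog2' : Real.log 2 < 1 := by have := Real.log_two_lt_d9; linarith
  by_cases hbig : 1 / 2 < ‖σ θ - 1‖
  · -- "we may assume `|Λ|` small": otherwise `log|Λ| > −log 2 > −1 ≥ −3X`
    have h2 : Real.log (1 / 2) < Real.log ‖σ θ - 1‖ := Real.log_lt_log (by norm_num) hbig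
    rw [one_div, Real.log_inv] at h2
    nlinarith only [h2, hX1, hlog2']
  push Not at hbig
  -- principal logarithms `lₖ = log σ(αₖ)`
  set l : κ → ℂ := fun k => Complex.log (σ (α k)) with hl
  have hσα : ∀ k, σ (α k) ≠ 0 := fun k => (map_ne_zero σ).mpr (hα k)
  have hexpl : ∀ k, Complex.exp (l k) = σ (α k) := fun k => Complex.exp_log (hσα k)
  have hl0 : ∀ k, α k ≠ 1 → l k ≠ 0 := by
    intro k hk1 hk
    have h1 : σ (α k) = 1 := by rw [← hexpl k, hk, Complex.exp_zero]
    exact hk1 (σ.injective (by rw [h1, map_one]))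
  have hl1 : ∀ k, α k = 1 → l k = 0 := by
    intro k hk; simp only [hl, hk, map_one, Complex.log_one]
  -- `Σ = ∑ bₖ lₖ`, `m = round(Im Σ/2π)`, `Σ' = −2m·πi + Σ`, `|Im Σ'| ≤ π`
  set S : ℂ := ∑ k, (b k : ℂ) * l k with hS
  set m : ℤ := round (S.im / (2 * Real.pi)) with hm
  set S' : ℂ := ((-(2 * m) : ℤ) : ℂ) * ((Real.pi : ℂ) * Complex.I) + S with hS'
  have hS'im : S'.im = S.im - 2 * Real.pi * m := by
    simp only [hS', Complex.add_im, Complex.mul_im, Complex.mul_re, Complex.I_re, Complex.I_im,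
      Complex.ofReal_re, Complex.ofReal_im, Complex.intCast_re, Complex.intCast_im]
    push_cast; ring
  have hr := abs_sub_round (S.im / (2 * Real.pi))
  rw [← hm] at hr
  have hS'imle : |S'.im| ≤ Real.pi := by
    rw [hS'im, show S.im - 2 * Real.pi * m = (2 * Real.pi) * (S.im / (2 * Real.pi) - m) by
      field_simp]
    rw [abs_mul, abs_of_pos (by positivity)]
    calc 2 * Real.pi * |S.im / (2 * Real.pi) - ↑m| ≤ 2 * Real.pi * (1 / 2) :=
          mul_le_mul_of_nonneg_left hr (by positivity)
      _ = Real.pi := by ring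
  -- `|Im Σ| ≤ π ∑|bₖ| ≤ π n B₁`
  have hImS : |S.im| ≤ Real.pi * ((n : ℝ) * B₁) := by
    rw [hS, Complex.im_sum]
    refine (Finset.abs_sum_le_sum_abs _ _).trans ?_
    have hterm : ∀ k ∈ (Finset.univ : Finset κ), |((b k : ℂ) * l k).im| ≤ Real.pi * B₁ := by
      intro k _
      have : ((b k : ℂ) * l k).im = (b k : ℝ) * (l k).im := by simp [Complex.mul_im]
      rw [this, abs_mul]
      have him : |(l k).im| ≤ Real.pi := by
        rw [hl]; simp only; rw [Complex.log_im]; exact Complex.abs_arg_le_pi _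
      calc |(b k : ℝ)| * |(l k).im| ≤ (B₁ : ℝ) * Real.pi :=
            mul_le_mul (hbB₁r k) him (abs_nonneg _) (by positivity)
        _ = Real.pi * B₁ := mul_comm _ _
    calc ∑ k, |((b k : ℂ) * l k).im| ≤ ∑ _k : κ, Real.pi * B₁ := Finset.sum_le_sum hterm
      _ = Real.pi * ((n : ℝ) * B₁) := by
          rw [Finset.sum_const, Finset.card_univ, nsmul_eq_mul, ← hndef]; ring
  -- `exp Σ' = exp Σ = σ θ`, `Σ' ≠ 0`
  have hexpS : Complex.exp S = σ θ := by
    rw [hθ, map_prod, hS, Complex.exp_sum]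
    refine Finset.prod_congr rfl fun k _ => ?_
    rw [map_zpow₀, ← hexpl k, ← Complex.exp_int_mul]
  have hexpS' : Complex.exp S' = σ θ := by
    rw [hS', Complex.exp_add, hexpS]
    have : ((-(2 * m) : ℤ) : ℂ) * ((Real.pi : ℂ) * Complex.I) =
        ((-m : ℤ) : ℂ) * (2 * Real.pi * Complex.I) := by push_cast; ring
    rw [this, Complex.exp_int_mul_two_pi_mul_I, one_mul]
  have hS'0 : S' ≠ 0 := by
    intro h0
    have h1 : σ θ = 1 := by rw [← hexpS', h0, Complex.exp_zero]
    exact hΛ (σ.injective (by rw [h1, map_one]))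
  -- `Σ' = log(1+Λ)` (principal) and `‖Σ'‖ ≤ (3/2)|Λ|`, so `|Λ| ≥ Ω/2`
  have hS'log : S' = Complex.log (1 + (σ θ - 1)) := by
    rw [add_sub_cancel, ← hexpS', Complex.log_exp]
    · rcases (abs_le.mp hS'imle).1.lt_or_eq with hlt | heq
      · exact hlt
      · exfalso
        have hex : Complex.exp S' = -(Real.exp S'.re : ℂ) := by
          rw [Complex.exp_eq_exp_re_mul_sin_add_cos, ← heq]
          simp [Complex.cos_neg, Complex.sin_neg]
        have : (1 : ℝ) < ‖σ θ - 1‖ := by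
          rw [← hexpS', hex, show -(Real.exp S'.re : ℂ) - 1 = -((Real.exp S'.re + 1 : ℝ) : ℂ) by
            push_cast; ring, norm_neg, Complex.norm_real, Real.norm_eq_abs,
            abs_of_pos (by positivity)]
          linarith [Real.exp_pos S'.re]
        linarith
    · exact (abs_le.mp hS'imle).2
  have hS'n : ‖S'‖ ≤ 3 / 2 * ‖σ θ - 1‖ := by
    rw [hS'log]; exact Complex.norm_log_one_add_half_le_self hbig
  have hS'n' : ‖S'‖ ≤ 3 / 4 := by linarith
  have hlogΛ : Real.log ‖S'‖ - Real.log 2 ≤ Real.log ‖σ θ - 1‖ := by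
    have hS'pos : 0 < ‖S'‖ := norm_pos_iff.mpr hS'0
    have h1 : ‖S'‖ / 2 ≤ ‖σ θ - 1‖ := by linarith [norm_nonneg (σ θ - 1)]
    have := Real.log_le_log (by positivity) h1
    rwa [Real.log_div hS'pos.ne' two_ne_zero] at this
  -- "`|b₀| ≤ nB`": `|2m| ≤ n B₁` (integrality: `|2πm| ≤ |Im Σ| + |Im Σ'| ≤ π n B₁ + 3/4`)
  have h2m : 2 * |(m : ℝ)| ≤ (n : ℝ) * B₁ := by
    have hImS' : |S'.im| ≤ 3 / 4 := (Complex.abs_im_le_norm S').trans hS'n'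
    have h1 : |2 * Real.pi * (m : ℝ)| ≤ Real.pi * ((n : ℝ) * B₁) + 3 / 4 := by
      have : 2 * Real.pi * (m : ℝ) = S.im - S'.im := by rw [hS'im]; ring
      rw [this]
      exact (abs_sub _ _).trans (add_le_add hImS hImS')
    rw [abs_mul, abs_of_pos (by positivity : (0:ℝ) < 2 * Real.pi)] at h1
    have h2 : 2 * |(m : ℝ)| < (n : ℝ) * B₁ + 1 := by
      by_contra hcon
      push Not at hcon
      -- `π (2|m| − n B₁) ≤ 3/4` but `2|m| − n B₁ ≥ 1` and `π > 3`
      have := mul_le_mul_of_nonneg_left hcon hπ0.le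
      nlinarith only [this, h1, hπ3]
    -- both sides are integers
    have h3 : ((2 * |m| : ℤ) : ℝ) < ((n * B₁ : ℕ) : ℝ) + 1 := by push_cast; linarith
    have h4 : (2 * |m| : ℤ) < (n * B₁ : ℕ) + 1 := by exact_mod_cast h3
    have h5 : (2 * |m| : ℤ) ≤ (n * B₁ : ℕ) := Int.lt_add_one_iff.mp h4
    have h6 : ((2 * |m| : ℤ) : ℝ) ≤ ((n * B₁ : ℕ) : ℝ) := by exact_mod_cast h5
    push_cast at h6
    exact h6
  ---- Cor. 2.3 for the `|S|+1` numbers `(−1; αₖ, k ∈ S)`, `S = {k : αₖ ≠ 1}`, exponents `(−2m; bₖ)`,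
  ---- `A = (π; Aₖ)`, `B = n B₁`, `ϰ = 2`
  set ι := Option {k : κ // α k ≠ 1}
  set α' : ι → K := fun o => o.elim (-1) (fun k => α k.1) with hα'
  set l' : ι → ℂ := fun o => o.elim ((Real.pi : ℂ) * Complex.I) (fun k => l k.1) with hl'
  set b' : ι → ℤ := fun o => o.elim (-(2 * m)) (fun k => b k.1) with hb'
  set A' : ι → ℝ := fun o => o.elim Real.pi (fun k => A k.1) with hA'
  set BM : ℝ := (n : ℝ) * B₁ with hBM
  -- `s = #S` as an opaque natural number (avoids `whnf` unfolding of `Fintype.card` in arithmetic)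
  obtain ⟨s, hsdef⟩ : ∃ s : ℕ, s = Fintype.card {k : κ // α k ≠ 1} := ⟨_, rfl⟩
  have hs1 : 1 ≤ s := by
    obtain ⟨k, hk⟩ := hα1
    rw [hsdef]; exact Fintype.card_pos_iff.mpr ⟨⟨k, hk⟩⟩
  have hsn : s ≤ n := by rw [hsdef, hndef]; exact Fintype.card_subtype_le _
  have hcardι : Fintype.card ι = s + 1 := by rw [Fintype.card_option, hsdef]
  have hcard' : 2 ≤ Fintype.card ι := by rw [hcardι]; omega
  have hπI0 : (Real.pi : ℂ) * Complex.I ≠ 0 := by simp [Complex.I_ne_zero, Real.pi_ne_zero]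
  have hπInorm : ‖(Real.pi : ℂ) * Complex.I‖ = Real.pi := by
    rw [norm_mul, Complex.norm_I, mul_one, Complex.norm_real, Real.norm_eq_abs, abs_of_pos hπ0]
  have hα'0 : ∀ o, α' o ≠ 0 := by
    rintro (_ | k)
    · simp [hα']
    · exact hα k.1
  have hexp' : ∀ o, Complex.exp (l' o) = σ (α' o) := by
    rintro (_ | k)
    · simp only [hl', hα', Option.elim]; rw [Complex.exp_pi_mul_I, map_neg, map_one]
    · exact hexpl k.1
  have hl'0 : ∀ o, l' o ≠ 0 := by
    rintro (_ | k)
    · exact hπI0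
    · exact hl0 k.1 k.2
  -- the linear form over `ι` is `Σ'` (the indices with `αₖ = 1` contribute `bₖ · 0`)
  have hsumS : ∑ k : {k : κ // α k ≠ 1}, (b k.1 : ℂ) * l k.1 = S := by
    rw [hS, ← Fintype.sum_subtype_add_sum_subtype (fun k : κ => α k ≠ 1)
      (fun k => (b k : ℂ) * l k)]
    have h0 : ∑ k : {k : κ // ¬(α k ≠ 1)}, (b k.1 : ℂ) * l k.1 = 0 := by
      refine Finset.sum_eq_zero fun k _ => ?_
      have hk : α k.1 = 1 := by have := k.2; push Not at this; exact this
      rw [hl1 k.1 hk, mul_zero]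
    rw [h0, add_zero]
  have hsum' : ∑ o, (b' o : ℂ) * l' o = S' := by
    rw [Fintype.sum_option, hS', ← hsumS]
    rfl
  have hsum'0 : ∑ o, (b' o : ℂ) * l' o ≠ 0 := by rw [hsum']; exact hS'0
  have hb'0 : b' ≠ 0 := by
    intro h0
    apply hsum'0
    simp [h0]
  have hA'' : ∀ o, max (logHeight₁ (α' o)) (max ‖l' o‖ 0.16) ≤ A' o := by
    rintro (_ | k)
    · simp only [hα', hl', hA', Option.elim]
      rw [logHeight₁_neg, logHeight₁_one, hπInorm]
      exact max_le hπ0.le (max_le le_rfl (by linarith))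
    · simp only [hα', hl', hA', Option.elim]
      exact hA k.1
  have hBM1 : 1 ≤ BM := one_le_mul_of_one_le_of_one_le hn1r hB₁1r
  have hBMk : ∀ o, (|b' o| : ℝ) ≤ BM := by
    rintro (_ | k)
    · simp only [hb', Option.elim]
      have : |(((-(2 * m) : ℤ) : ℝ))| = 2 * |(m : ℝ)| := by
        push_cast; rw [abs_neg, abs_mul, abs_two]
      rw [this]
      exact h2m
    · simp only [hb', Option.elim]
      exact (hbB₁r k.1).trans (le_mul_of_one_le_left (by positivity) hn1r)
  -- `∏ A' = π ∏_S A` (`PS = ∏_S A` as an opaque real)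
  obtain ⟨PS, hPSdef⟩ : ∃ x : ℝ, x = ∏ k : {k : κ // α k ≠ 1}, A k.1 := ⟨_, rfl⟩
  have hprodA' : ∏ o, A' o = Real.pi * PS := by
    rw [Fintype.prod_option, hPSdef]
    rfl
  -- the pieces of the comparison `C₁(s+1)·π·PS·log(e·nB₁) + log 2 ≤ 3X`
  -- (1) `log(e · n B₁) ≤ L`
  have hBM0 : 0 < BM := by linarith only [hBM1]
  have hLM : Real.log (E * BM) ≤ L := by
    rw [hLdef, Real.log_mul hE0.ne' hBM0.ne', hEdef, Real.log_exp]
    have : Real.log BM ≤ Real.log (n * B) :=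
      Real.log_le_log hBM0 (mul_le_mul_of_nonneg_left hB₁B (by positivity))
    linarith only [this]
  have hLM0 : 0 < Real.log (E * BM) := by
    rw [Real.log_mul hE0.ne' hBM0.ne', hEdef, Real.log_exp]
    exact add_pos_of_pos_of_nonneg one_pos (Real.log_nonneg hBM1)
  -- (2) `D² log(eD) = LD2`
  have hD0r : (D : ℝ) ≠ 0 := by exact_mod_cast hD0.ne'
  have hLD : (D : ℝ) ^ 2 * Real.log (E * D) = LD2 := by
    rw [hLD2def, Real.log_mul hE0.ne' hD0r, hEdef, Real.log_exp]
  -- (3) `30^{s+4} · PS ≤ 30^{n+4} · Ω` (dropping the `αₖ = 1` indices: `30·Aₖ ≥ 4.8 ≥ 1`)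
  have hPS0 : 0 < PS := by rw [hPSdef]; exact Finset.prod_pos fun k _ => hApos k.1
  have hdrop : (30 : ℝ) ^ (s + 1 + 3) * PS ≤ 30 ^ (n + 4) * Ω := by
    obtain ⟨PT, hPTdef⟩ : ∃ x : ℝ, x = ∏ k : {k : κ // ¬(α k ≠ 1)}, A k.1 := ⟨_, rfl⟩
    have hsplit : PS * PT = Ω := by
      rw [hPSdef, hPTdef, hΩdef]; exact Fintype.prod_subtype_mul_prod_subtype (fun k => α k ≠ 1) A
    have ht : Fintype.card {k : κ // ¬(α k ≠ 1)} = n - s := by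
      rw [Fintype.card_subtype_compl, ← hndef, ← hsdef]
    have hT0 : (1 : ℝ) ≤ 30 ^ Fintype.card {k : κ // ¬(α k ≠ 1)} * PT := by
      rw [hPTdef]
      exact bms_one_le_pow_mul_prod (fun k : {k : κ // ¬(α k ≠ 1)} => A k.1) (fun k => hA16 k.1)
    have hT : (1 : ℝ) ≤ 30 ^ (n - s) * PT := by rw [← ht]; exact hT0
    have hexp : s + 1 + 3 + (n - s) = n + 4 := by omega
    have hpow : (30 : ℝ) ^ (n + 4) = 30 ^ (s + 1 + 3) * 30 ^ (n - s) := by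
      rw [← pow_add, hexp]
    have hpre : (0 : ℝ) ≤ 30 ^ (s + 1 + 3) * PS := mul_nonneg (pow_nonneg (by norm_num) _) hPS0.le
    calc (30 : ℝ) ^ (s + 1 + 3) * PS = 30 ^ (s + 1 + 3) * PS * 1 := (mul_one _).symm
      _ ≤ 30 ^ (s + 1 + 3) * PS * (30 ^ (n - s) * PT) := mul_le_mul_of_nonneg_left hT hpre
      _ = 30 ^ (n + 4) * (PS * PT) := by rw [hpow]; ring
      _ = 30 ^ (n + 4) * Ω := by rw [hsplit]
  -- (4) `(s+1)^{5.5} ≤ (n+1)^{5.5}` and `(e(s+1)/2)²·(s+1)^{3.5} = (e²/4)(s+1)^{5.5}`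
  have hs1r : ((s : ℝ) + 1) ≤ (n : ℝ) + 1 := by
    have : (s : ℝ) ≤ n := by exact_mod_cast hsn
    linarith only [this]
  have hs0r : (0 : ℝ) < (s : ℝ) + 1 := by positivity
  have hspow : ((s : ℝ) + 1) ^ 2 * ((s : ℝ) + 1) ^ (7 / 2 : ℝ) = ((s : ℝ) + 1) ^ (11 / 2 : ℝ) := by
    rw [← Real.rpow_natCast ((s : ℝ) + 1) 2, ← Real.rpow_add hs0r]; norm_num
  have hs55 : ((s : ℝ) + 1) ^ (11 / 2 : ℝ) ≤ ((n : ℝ) + 1) ^ (11 / 2 : ℝ) :=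
    Real.rpow_le_rpow hs0r.le hs1r (by norm_num)
  -- (5) the constant: `min(…) ≤ first branch`
  set C₁ : ℝ := min (1 / (2 : ℝ) * (E * ((s : ℝ) + 1) / 2) ^ 2 * 30 ^ (s + 1 + 3) *
      ((s : ℝ) + 1) ^ (7 / 2 : ℝ)) ((2 : ℝ) ^ (6 * (s + 1) + 20)) with hC₁
  have hC₁le : C₁ ≤ E ^ 2 / 8 * (30 ^ (s + 1 + 3) * ((s : ℝ) + 1) ^ (11 / 2 : ℝ)) := by
    refine (min_le_left _ _).trans (le_of_eq ?_)
    rw [← hspow]; ring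
  have hC₁0 : 0 ≤ C₁ := by
    rw [hC₁]; exact le_min (by positivity) (by positivity)
  -- assemble: `C₁ · LD2 · (π PS) · log(e BM) ≤ (π e²/8) · X`
  have hkey : C₁ * LD2 * (Real.pi * PS) * Real.log (E * BM) ≤ Real.pi * E ^ 2 / 8 * X := by
    have h1 : C₁ * LD2 * (Real.pi * PS) * Real.log (E * BM) ≤ C₁ * LD2 * (Real.pi * PS) * L :=
      mul_le_mul_of_nonneg_left hLM
        (mul_nonneg (mul_nonneg hC₁0 (by linarith only [hLD2])) (mul_nonneg hπ0.le hPS0.le))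
    have hLPL : 0 ≤ LD2 * (Real.pi * PS) * L :=
      mul_nonneg (mul_nonneg (by linarith only [hLD2]) (mul_nonneg hπ0.le hPS0.le))
        (by linarith only [hL1])
    have h2 : C₁ * LD2 * (Real.pi * PS) * L ≤
        (E ^ 2 / 8 * (30 ^ (s + 1 + 3) * ((s : ℝ) + 1) ^ (11 / 2 : ℝ))) * LD2 * (Real.pi * PS) * L := by
      have := mul_le_mul_of_nonneg_right hC₁le hLPL
      calc C₁ * LD2 * (Real.pi * PS) * L = C₁ * (LD2 * (Real.pi * PS) * L) := by ring
        _ ≤ (E ^ 2 / 8 * (30 ^ (s + 1 + 3) * ((s : ℝ) + 1) ^ (11 / 2 : ℝ))) *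
              (LD2 * (Real.pi * PS) * L) := this
        _ = _ := by ring
    have h3 : (E ^ 2 / 8 * (30 ^ (s + 1 + 3) * ((s : ℝ) + 1) ^ (11 / 2 : ℝ))) * LD2 * (Real.pi * PS) * L
        = Real.pi * E ^ 2 / 8 * ((30 ^ (s + 1 + 3) * PS) * ((s : ℝ) + 1) ^ (11 / 2 : ℝ) * LD2 * L) := by
      ring
    have h4 : (30 ^ (s + 1 + 3) * PS) * ((s : ℝ) + 1) ^ (11 / 2 : ℝ) * LD2 * L ≤
        (30 ^ (n + 4) * Ω) * ((n : ℝ) + 1) ^ (11 / 2 : ℝ) * LD2 * L := by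
      have hb : 0 ≤ ((s : ℝ) + 1) ^ (11 / 2 : ℝ) := by positivity
      have hc : 0 ≤ LD2 * L := mul_nonneg (by linarith only [hLD2]) (by linarith only [hL1])
      have hd : 0 ≤ (30 : ℝ) ^ (n + 4) * Ω := mul_nonneg (pow_nonneg (by norm_num) _) hΩ0.le
      calc (30 ^ (s + 1 + 3) * PS) * ((s : ℝ) + 1) ^ (11 / 2 : ℝ) * LD2 * L
          = ((30 ^ (s + 1 + 3) * PS) * ((s : ℝ) + 1) ^ (11 / 2 : ℝ)) * (LD2 * L) := by ring
        _ ≤ ((30 ^ (n + 4) * Ω) * ((n : ℝ) + 1) ^ (11 / 2 : ℝ)) * (LD2 * L) :=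
            mul_le_mul_of_nonneg_right (mul_le_mul hdrop hs55 hb hd) hc
        _ = (30 ^ (n + 4) * Ω) * ((n : ℝ) + 1) ^ (11 / 2 : ℝ) * LD2 * L := by ring
    have h5 : X = (30 ^ (n + 4) * Ω) * ((n : ℝ) + 1) ^ (11 / 2 : ℝ) * LD2 * L := by
      rw [hXdef]; ring
    have hπE : 0 ≤ Real.pi * E ^ 2 / 8 := by positivity
    calc C₁ * LD2 * (Real.pi * PS) * Real.log (E * BM) ≤ C₁ * LD2 * (Real.pi * PS) * L := h1
      _ ≤ (E ^ 2 / 8 * (30 ^ (s + 1 + 3) * ((s : ℝ) + 1) ^ (11 / 2 : ℝ))) * LD2 * (Real.pi * PS) * L := h2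
      _ = Real.pi * E ^ 2 / 8 * ((30 ^ (s + 1 + 3) * PS) * ((s : ℝ) + 1) ^ (11 / 2 : ℝ) * LD2 * L) := h3
      _ ≤ Real.pi * E ^ 2 / 8 * X := by rw [h5]; exact mul_le_mul_of_nonneg_left h4 hπE
  have hconst : Real.pi * E ^ 2 / 8 < 2902 / 1000 := by rw [hEdef]; exact bms_pi_mul_exp_sq_lt
  have hX0 : 0 < X := lt_of_lt_of_le (by norm_num) hX1
  -- `log|Λ| ≥ log Ω − log 2 > −C₁ LD2 (π PS) log(e BM) − log 2 ≥ −2.902 X − log 2 ≥ −3X`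
  have hfin : C₁ * LD2 * (Real.pi * PS) * Real.log (E * BM) + Real.log 2 ≤ 3 * X := by
    have hA : Real.pi * E ^ 2 / 8 * X ≤ 2902 / 1000 * X := mul_le_mul_of_nonneg_right hconst.le hX0.le
    linarith only [hkey, hA, hX1, hlog2']
  ---- Matveev's Cor. 2.3 (the typed fact, `B ↦ max|bᵢ|` form), `ϰ = 2`
  have hM := matveev2000_linearFormsLog_nf_bstar h K σ 2 (Or.inl rfl) ι hcard' α' l' b' A' BM
    hα'0 hexp' hl'0 hb'0 hsum'0 hA'' hBM1 hBMk
  rw [hsum', hprodA', hcardι, ← hEdef, ← hDdef] at hM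
  push_cast at hM
  rw [hLD, ← hC₁] at hM
  linarith only [hM, hlogΛ, hfin]

/-! #### Bugeaud–Mignotte–Siksek 2006, Theorem 9.4 — the real clause -/

/-- **Bugeaud–Mignotte–Siksek 2006 (Ann. of Math. 163), Theorem 9.4, second clause ("if `𝕃` is
real"), GENERAL (real-embedded) number field, PROVED from Matveev's Cor. 2.3
(`matveev2000_linearFormsLog_nf`, `ϰ = 1`).** With the notation of
`bugeaudMignotteSiksek2006_thm_9_4_nf_of_matveev`, suppose the embedding `σ` is REAL
(`σ(K) ⊂ ℝ`). Then `log|Λ| > −1.4·30^{n+3}·n^{4.5}·D²·(1 + log D)·(1 + log B)·A₁⋯Aₙ`.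
TYPED UNDER TWO EXTRA HYPOTHESES (WEAKER than print, see the module docstring): `n ≥ 2` and
`αₖ ≠ ±1` for every `k` — the printed proof ("`b₀ = 0` if `𝕃` is real", then Cor. 2.3) uses the real
logarithms `log|σ αₖ|`, which must be non-zero and at least two in number for Cor. 2.3 (typed for
`n ≥ 2` non-zero logarithms) to apply with the constant `(e/2)·30^{n+3}n^{4.5} < 1.4·30^{n+3}n^{4.5}`.
Proof: `σ(αₖ) ∈ ℝ*`; with `α'ₖ = ±αₖ`, `σ(α'ₖ) = |σ αₖ| > 0`, `lₖ = log|σαₖ| ≠ 0` (as `αₖ ≠ ±1`),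
`h(α'ₖ) = h(αₖ)`, `|lₖ| = |Re log σαₖ| ≤ |log σαₖ|`; `∑ bₖlₖ = log|σ(∏αₖ^{bₖ})| = log|1+Λ|`, and
`|log|1+Λ|| ≤ ‖log(1+Λ)‖ ≤ (3/2)|Λ|` for `|Λ| ≤ ½`; Cor. 2.3 (`ϰ = 1`, "`B ↦ max|bᵢ|`" form).
WHAT THIS IS NOT: not the clause for configurations with some `αₖ = ±1` or `n = 1`; nothing of
Matveev is proved; typed ≠ proved ≠ endorsed.
[cite: BugeaudMignotteSiksek2006, Theorem 9.4 (second clause) with proof, §9.1]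
[cite: Matveev2000, Corollary 2.3] [cite: EvertseGyory2015, Thm 3.2.4 (p. 61)] -/
theorem bugeaudMignotteSiksek2006_thm_9_4_real_nf_of_matveev (h : matveev2000_linearFormsLog_nf) :
    ∀ (K : Type) [Field K] [NumberField K] (σ : K →+* ℂ), ComplexEmbedding.IsReal σ →
    ∀ (κ : Type) [Fintype κ], 2 ≤ Fintype.card κ →
    ∀ (α : κ → K) (b : κ → ℤ) (A : κ → ℝ) (B : ℝ),
      (∀ k, α k ≠ 0) → (∀ k, α k ≠ 1) → (∀ k, α k ≠ -1) → ∏ k, α k ^ b k ≠ 1 →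
      (∀ k, (|b k| : ℝ) ≤ B) →
      (∀ k, max (logHeight₁ (α k)) (max ‖Complex.log (σ (α k))‖ 0.16) ≤ A k) →
      -((1.4 : ℝ) * 30 ^ (Fintype.card κ + 3) * (Fintype.card κ : ℝ) ^ (9 / 2 : ℝ) *
          ((Module.finrank ℚ K : ℝ) ^ 2 * (1 + Real.log (Module.finrank ℚ K))) *
          (1 + Real.log B) * ∏ k, A k) <
        Real.log ‖σ (∏ k, α k ^ b k) - 1‖ := by
  intro K _ _ σ hσ κ _ hcard α b A B hα hα1 hαm1 hΛ hbB hA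
  classical
  set n : ℕ := Fintype.card κ with hndef
  set D : ℕ := Module.finrank ℚ K with hDdef
  set E : ℝ := Real.exp 1 with hEdef
  have hE0 : 0 < E := Real.exp_pos 1
  have hπ3 : 3 < Real.pi := Real.pi_gt_three
  have hπ0 : 0 < Real.pi := Real.pi_pos
  have hD0 : 0 < D := Module.finrank_pos
  have hD1 : (1 : ℝ) ≤ D := by exact_mod_cast hD0
  have hn2r : (2 : ℝ) ≤ n := by exact_mod_cast hcard
  have hn0r : (0 : ℝ) < n := by linarith
  -- the data `A`
  have hA16 : ∀ k, (0.16 : ℝ) ≤ A k := fun k =>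
    le_trans (le_max_right _ _) (le_trans (le_max_right _ _) (hA k))
  have hApos : ∀ k, 0 < A k := fun k => lt_of_lt_of_le (by norm_num) (hA16 k)
  have hAl : ∀ k, ‖Complex.log (σ (α k))‖ ≤ A k := fun k =>
    le_trans (le_max_left _ _) (le_trans (le_max_right _ _) (hA k))
  have hAh : ∀ k, logHeight₁ (α k) ≤ A k := fun k => le_trans (le_max_left _ _) (hA k)
  -- `θ = ∏ αₖ^{bₖ} ≠ 1`: some `bₖ ≠ 0`, so `B ≥ 1`
  set θ : K := ∏ k, α k ^ b k with hθ
  have hb0 : ∃ k, b k ≠ 0 := by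
    by_contra hall
    push Not at hall
    exact hΛ (by simp [hθ, hall])
  obtain ⟨k₁, hk₁⟩ := hb0
  have hB1 : (1 : ℝ) ≤ B := le_trans (by exact_mod_cast Int.one_le_abs hk₁) (hbB k₁)
  have hB0 : 0 < B := by linarith
  have hbne : b ≠ 0 := fun h0 => hk₁ (by rw [h0]; rfl)
  -- `LD2 = D²(1 + log D) ≥ 1`, `L = 1 + log B ≥ 1`, `Ω = ∏ A`, `Y`
  set LD2 : ℝ := (D : ℝ) ^ 2 * (1 + Real.log D) with hLD2def
  have hlogD0 : 0 ≤ Real.log D := Real.log_nonneg hD1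
  have hLD2 : 1 ≤ LD2 := one_le_mul_of_one_le_of_one_le (one_le_pow₀ hD1) (by linarith)
  set L : ℝ := 1 + Real.log B with hLdef
  have hL1 : 1 ≤ L := by have := Real.log_nonneg hB1; rw [hLdef]; linarith
  set Ω : ℝ := ∏ k, A k with hΩdef
  have hΩ0 : 0 < Ω := Finset.prod_pos fun k _ => hApos k
  have h30Ω : (1 : ℝ) ≤ 30 ^ n * Ω := bms_one_le_pow_mul_prod A hA16
  have hn45 : (1 : ℝ) ≤ (n : ℝ) ^ (9 / 2 : ℝ) := Real.one_le_rpow (by linarith) (by norm_num)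
  set Y : ℝ := 30 ^ (n + 3) * (n : ℝ) ^ (9 / 2 : ℝ) * LD2 * L * Ω with hYdef
  have hY1 : (30 : ℝ) ^ 3 ≤ Y := by
    have h1 : Y = 30 ^ 3 * ((30 ^ n * Ω) * ((n : ℝ) ^ (9 / 2 : ℝ) * (LD2 * L))) := by
      rw [hYdef, pow_add]; ring
    rw [h1]
    have h2 : (1 : ℝ) ≤ LD2 * L := one_le_mul_of_one_le_of_one_le hLD2 hL1
    have h3 : (1 : ℝ) ≤ (n : ℝ) ^ (9 / 2 : ℝ) * (LD2 * L) := one_le_mul_of_one_le_of_one_le hn45 h2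
    have h4 : (1 : ℝ) ≤ (30 ^ n * Ω) * ((n : ℝ) ^ (9 / 2 : ℝ) * (LD2 * L)) :=
      one_le_mul_of_one_le_of_one_le h30Ω h3
    calc (30 : ℝ) ^ 3 = 30 ^ 3 * 1 := (mul_one _).symm
      _ ≤ 30 ^ 3 * ((30 ^ n * Ω) * ((n : ℝ) ^ (9 / 2 : ℝ) * (LD2 * L))) :=
          mul_le_mul_of_nonneg_left h4 (by norm_num)
  have hY0 : 0 < Y := lt_of_lt_of_le (by norm_num) hY1
  have hgoal : (1.4 : ℝ) * 30 ^ (n + 3) * (n : ℝ) ^ (9 / 2 : ℝ) * LD2 * L * Ω = 1.4 * Y := by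
    rw [hYdef]; ring
  rw [hgoal]
  -- `Λ = σ θ − 1 ≠ 0`
  have hθ0 : θ ≠ 0 := by
    rw [hθ]; exact Finset.prod_ne_zero_iff.mpr fun k _ => zpow_ne_zero _ (hα k)
  have hσθ1 : σ θ - 1 ≠ 0 := by
    rw [← map_one σ, ← map_sub]; exact (map_ne_zero σ).mpr (sub_ne_zero.mpr hΛ)
  have hw0 : 0 < ‖σ θ - 1‖ := norm_pos_iff.mpr hσθ1
  have hlog2' : Real.log 2 < 1 := by have := Real.log_two_lt_d9; linarith
  by_cases hbig : 1 / 2 < ‖σ θ - 1‖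
  · -- otherwise `log|Λ| > −log 2 > −1 ≥ −1.4Y`
    have h2 : Real.log (1 / 2) < Real.log ‖σ θ - 1‖ := Real.log_lt_log (by norm_num) hbig
    rw [one_div, Real.log_inv] at h2
    nlinarith only [h2, hY1, hlog2']
  push Not at hbig
  -- the real picture: `σ(αₖ) = rₖ ∈ ℝ*`, `|rₖ| ≠ 1`
  set r : κ → ℝ := fun k => hσ.embedding (α k) with hr
  have hσr : ∀ k, σ (α k) = ((r k : ℝ) : ℂ) := fun k =>
    (ComplexEmbedding.IsReal.coe_embedding_apply hσ (α k)).symm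
  have hr0 : ∀ k, r k ≠ 0 := by
    intro k h0
    apply (map_ne_zero σ).mpr (hα k)
    rw [hσr k, h0]; simp
  have hr1 : ∀ k, |r k| ≠ 1 := by
    intro k h1
    rcases (abs_eq zero_le_one).mp h1 with h2 | h2
    · exact hα1 k (σ.injective (by rw [hσr k, h2, map_one]; simp))
    · exact hαm1 k (σ.injective (by rw [hσr k, h2, map_neg, map_one]; simp))
  -- real logarithms `lₖ = log|rₖ| ≠ 0`, `α'ₖ = ±αₖ` with `σ(α'ₖ) = |rₖ|`
  set l : κ → ℂ := fun k => ((Real.log |r k| : ℝ) : ℂ) with hl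
  set α' : κ → K := fun k => if r k < 0 then -α k else α k with hα'
  have hσα' : ∀ k, σ (α' k) = ((|r k| : ℝ) : ℂ) := by
    intro k
    simp only [hα']
    split_ifs with hneg
    · rw [map_neg, hσr k, abs_of_neg hneg]; push_cast; ring
    · rw [hσr k, abs_of_nonneg (not_lt.mp hneg)]
  have hα'0 : ∀ k, α' k ≠ 0 := by
    intro k
    simp only [hα']
    split_ifs
    · exact neg_ne_zero.mpr (hα k)
    · exact hα k
  have hexpl : ∀ k, Complex.exp (l k) = σ (α' k) := by
    intro k
    rw [hσα' k]
    simp only [hl]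
    rw [← Complex.ofReal_exp, Real.exp_log (abs_pos.mpr (hr0 k))]
  have hl0 : ∀ k, l k ≠ 0 := by
    intro k
    simp only [hl, ne_eq, Complex.ofReal_eq_zero]
    exact Real.log_ne_zero_of_pos_of_ne_one (abs_pos.mpr (hr0 k)) (hr1 k)
  -- the `A`-condition for `(α', l)`
  have hA' : ∀ k, max (logHeight₁ (α' k)) (max ‖l k‖ 0.16) ≤ A k := by
    intro k
    have hh : logHeight₁ (α' k) = logHeight₁ (α k) := by
      simp only [hα']
      split_ifs
      · exact logHeight₁_neg _
      · rfl
    have hnorm : ‖l k‖ ≤ ‖Complex.log (σ (α k))‖ := by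
      simp only [hl, Complex.norm_real, Real.norm_eq_abs]
      have : Real.log |r k| = (Complex.log (σ (α k))).re := by
        rw [Complex.log_re, hσr k, Complex.norm_real, Real.norm_eq_abs]
      rw [this]
      exact Complex.abs_re_le_norm _
    rw [hh]
    exact max_le (hAh k) (max_le (hnorm.trans (hAl k)) (hA16 k))
  -- the linear form is REAL: `∑ bₖ lₖ = log|σ θ|`
  have hnormθ : ‖σ θ‖ = ∏ k, |r k| ^ b k := by
    rw [hθ, map_prod, norm_prod]
    refine Finset.prod_congr rfl fun k _ => ?_
    rw [map_zpow₀, norm_zpow, hσr k, Complex.norm_real, Real.norm_eq_abs]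
  obtain ⟨Sr, hSr⟩ : ∃ x : ℝ, x = Real.log ‖σ θ‖ := ⟨_, rfl⟩
  have hSsum : ∑ k, (b k : ℂ) * l k = ((Sr : ℝ) : ℂ) := by
    rw [hSr, hnormθ, Real.log_prod]
    · push_cast
      refine Finset.sum_congr rfl fun k _ => ?_
      rw [Real.log_zpow]
      simp only [hl]
      push_cast
      ring
    · intro k _
      exact zpow_ne_zero _ (abs_ne_zero.mpr (hr0 k))
  have hσθr : σ θ = ((hσ.embedding θ : ℝ) : ℂ) :=
    (ComplexEmbedding.IsReal.coe_embedding_apply hσ θ).symm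
  have hnθ0 : 0 < ‖σ θ‖ := norm_pos_iff.mpr ((map_ne_zero σ).mpr hθ0)
  -- `Sr ≠ 0`: otherwise `|σ θ| = 1`, i.e. `σ θ = ±1`: `θ = 1` is excluded, `σ θ = −1` gives `|Λ| = 2`
  have hSr0 : Sr ≠ 0 := by
    intro h0
    rw [hSr] at h0
    have h1 : ‖σ θ‖ = 1 := by
      rcases Real.log_eq_zero.mp h0 with h2 | h2 | h2
      · exact absurd h2 hnθ0.ne'
      · exact h2
      · linarith [norm_nonneg (σ θ)]
    rw [hσθr, Complex.norm_real, Real.norm_eq_abs] at h1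
    rcases (abs_eq zero_le_one).mp h1 with h2 | h2
    · exact hΛ (σ.injective (by rw [hσθr, h2, map_one]; simp))
    · have h3 : ‖σ θ - 1‖ = 2 := by
        rw [hσθr, h2]
        norm_num
      linarith [hbig, h3]
  -- `|Sr| = |Re log(1+Λ)| ≤ ‖log(1+Λ)‖ ≤ (3/2)|Λ|`, so `|Λ| ≥ |Sr|/2`
  have hSrle : |Sr| ≤ 3 / 2 * ‖σ θ - 1‖ := by
    have h1 : Sr = (Complex.log (1 + (σ θ - 1))).re := by rw [add_sub_cancel, Complex.log_re, hSr]
    rw [h1]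
    exact (Complex.abs_re_le_norm _).trans (Complex.norm_log_one_add_half_le_self hbig)
  have hlogΛ : Real.log |Sr| - Real.log 2 ≤ Real.log ‖σ θ - 1‖ := by
    have hpos : 0 < |Sr| := abs_pos.mpr hSr0
    have h1 : |Sr| / 2 ≤ ‖σ θ - 1‖ := by linarith only [hSrle, norm_nonneg (σ θ - 1)]
    have := Real.log_le_log (by positivity) h1
    rwa [Real.log_div hpos.ne' two_ne_zero] at this
  have hsum0 : ∑ k, (b k : ℂ) * l k ≠ 0 := by
    rw [hSsum]; exact_mod_cast hSr0
  -- the constant: `C₁(n, ϰ = 1) ≤ (e/2)·30^{n+3} n^{4.5}`, `e/2 < 1.3592`, slack `0.0408 Y ≥ log 2`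
  set C₁ : ℝ := min (1 / (1 : ℝ) * (E * (n : ℝ) / 2) ^ 1 * 30 ^ (n + 3) * (n : ℝ) ^ (7 / 2 : ℝ))
      ((2 : ℝ) ^ (6 * n + 20)) with hC₁
  have hnpow : (n : ℝ) * (n : ℝ) ^ (7 / 2 : ℝ) = (n : ℝ) ^ (9 / 2 : ℝ) := by
    rw [← Real.rpow_one_add' hn0r.le (by norm_num)]; norm_num
  have hC₁le : C₁ ≤ E / 2 * (30 ^ (n + 3) * (n : ℝ) ^ (9 / 2 : ℝ)) := by
    refine (min_le_left _ _).trans (le_of_eq ?_)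
    rw [← hnpow]; ring
  have hC₁0 : 0 ≤ C₁ := by
    rw [hC₁]; exact le_min (by positivity) (by positivity)
  have hD0r : (D : ℝ) ≠ 0 := by exact_mod_cast hD0.ne'
  have hLD : (D : ℝ) ^ 2 * Real.log (E * D) = LD2 := by
    rw [hLD2def, Real.log_mul hE0.ne' hD0r, hEdef, Real.log_exp]
  have hLB : Real.log (E * B) = L := by
    rw [hLdef, Real.log_mul hE0.ne' hB0.ne', hEdef, Real.log_exp]
  have hkey : C₁ * LD2 * Ω * Real.log (E * B) ≤ E / 2 * Y := by
    rw [hLB]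
    have hnn : 0 ≤ LD2 * Ω * L :=
      mul_nonneg (mul_nonneg (by linarith only [hLD2]) hΩ0.le) (by linarith only [hL1])
    calc C₁ * LD2 * Ω * L = C₁ * (LD2 * Ω * L) := by ring
      _ ≤ (E / 2 * (30 ^ (n + 3) * (n : ℝ) ^ (9 / 2 : ℝ))) * (LD2 * Ω * L) :=
          mul_le_mul_of_nonneg_right hC₁le hnn
      _ = E / 2 * Y := by rw [hYdef]; ring
  have hconst : E / 2 < 13592 / 10000 := by rw [hEdef]; exact bms_exp_div_two_lt
  have hfin : C₁ * LD2 * Ω * Real.log (E * B) + Real.log 2 ≤ 1.4 * Y := by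
    have hA2 : E / 2 * Y ≤ 13592 / 10000 * Y := mul_le_mul_of_nonneg_right hconst.le hY0.le
    norm_num
    linarith only [hkey, hA2, hY1, hlog2']
  ---- Matveev's Cor. 2.3 (the typed fact, `B ↦ max|bᵢ|` form), `ϰ = 1` (σ real)
  have hM := matveev2000_linearFormsLog_nf_bstar h K σ 1 (Or.inr ⟨hσ, rfl⟩) κ hcard α' l b A B
    hα'0 hexpl hl0 hbne hsum0 hA' hB1 hbB
  rw [hSsum, Complex.norm_real, Real.norm_eq_abs, ← hEdef, ← hDdef, ← hndef, ← hΩdef] at hM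
  push_cast at hM
  rw [hLD, ← hC₁] at hM
  linarith only [hM, hlogΛ, hfin]

/-! #### Gherga–Siksek 2025, Theorem 2 ("Matveev") — at an infinite place, as printed -/

/-- **Gherga–Siksek 2025 (Algebra & Number Theory 19), §5.2, Theorem 2 ("Matveev"), GENERAL number
field, PROVED AS PRINTED** (from the first clause of BMS Thm. 9.4 above, hence from
`matveev2000_linearFormsLog_nf`). Let `L` (here `K`) be a number field of degree `D`, `ν` (here `w`)
an infinite place, `‖x‖_ν = |x|_ν^{D_ν}` (`|x|_ν = |σ(x)|` for an embedding `σ` of `ν`, `D_ν = 1` or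
`2` — Mathlib: `w x ^ w.mult`); `α₁,…,αₙ ∈ K*`, `b ∈ ℤⁿ`, `B ≥ max|bⱼ|` (print: `B = max|bⱼ|`),
`Λ = α₁^{b₁}⋯αₙ^{bₙ} − 1 ≠ 0`, `h'ⱼ = √(h(αⱼ)² + π²/D²)` (`h` = absolute logarithmic height =
`logHeight₁/D`), `c₅ = 6·30^{n+4}·(n+1)^{5.5}·D^{n+2}·log(eD)·h'₁⋯h'ₙ`. Then
`log ‖Λ⁻¹‖_ν ≤ c₅ · (log(en) + log B)`; typed as `−c₅ (log(en) + log B) < mult(w) · log w(Λ)`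
(`log ‖Λ⁻¹‖_ν = −mult(w) log w(Λ)`; strict). Proof as printed: BMS Thm. 9.4 with
`Aⱼ = D h'ⱼ ≥ max{D h(αⱼ), |log σ(αⱼ)|, 0.16}` (`|log σ(αⱼ)| ≤ √(D²h(αⱼ)² + π²)` from
`log|σ(αⱼ)| ≤ D h(αⱼ)`), `D_ν ≤ 2`, `1 + log(nB) = log(en) + log B`. FAITHFUL.
WHAT THIS IS NOT: nothing of Matveev is proved; typed ≠ proved ≠ endorsed.
[cite: GhergaSiksek2025, §5.2 Theorem 2 (Matveev) with proof]
[cite: BugeaudMignotteSiksek2006, Theorem 9.4] [cite: Matveev2000, Corollary 2.3] -/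
theorem ghergaSiksek2025_thm2_nf_of_matveev (h : matveev2000_linearFormsLog_nf) :
    ∀ (K : Type) [Field K] [NumberField K] (w : InfinitePlace K) (κ : Type) [Fintype κ]
      (α : κ → K) (b : κ → ℤ) (B : ℝ),
      (∀ k, α k ≠ 0) → ∏ k, α k ^ b k ≠ 1 → (∀ k, (|b k| : ℝ) ≤ B) →
      -(6 * 30 ^ (Fintype.card κ + 4) * ((Fintype.card κ : ℝ) + 1) ^ (11 / 2 : ℝ) *
          (Module.finrank ℚ K : ℝ) ^ (Fintype.card κ + 2) *
          Real.log (Real.exp 1 * Module.finrank ℚ K) *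
          (∏ k, Real.sqrt ((logHeight₁ (α k) / Module.finrank ℚ K) ^ 2 +
            Real.pi ^ 2 / (Module.finrank ℚ K : ℝ) ^ 2)) *
          (Real.log (Real.exp 1 * Fintype.card κ) + Real.log B)) <
        (w.mult : ℝ) * Real.log (w (∏ k, α k ^ b k - 1)) := by
  intro K _ _ w κ _ α b B hα hΛ hbB
  classical
  set n : ℕ := Fintype.card κ with hndef
  set D : ℕ := Module.finrank ℚ K with hDdef
  set E : ℝ := Real.exp 1 with hEdef
  have hE0 : 0 < E := Real.exp_pos 1
  have hπ3 : 3 < Real.pi := Real.pi_gt_three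
  have hπ0 : 0 < Real.pi := Real.pi_pos
  have hD0 : 0 < D := Module.finrank_pos
  have hD0r : (0 : ℝ) < D := by exact_mod_cast hD0
  have hD1 : (1 : ℝ) ≤ D := by exact_mod_cast hD0
  set σ : K →+* ℂ := w.embedding with hσdef
  have hwx : ∀ x, w x = ‖σ x‖ := fun x => (InfinitePlace.norm_embedding_eq w x).symm
  -- `Aⱼ := √(logHeight₁(αⱼ)² + π²) = D h'ⱼ`
  set A : κ → ℝ := fun k => Real.sqrt (logHeight₁ (α k) ^ 2 + Real.pi ^ 2) with hAdef
  have hAπ : ∀ k, Real.pi ≤ A k := fun k =>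
    (Real.le_sqrt hπ0.le (by positivity)).mpr (by nlinarith [sq_nonneg (logHeight₁ (α k))])
  have hApos : ∀ k, 0 < A k := fun k => lt_of_lt_of_le hπ0 (hAπ k)
  have hA : ∀ k, max (logHeight₁ (α k)) (max ‖Complex.log (σ (α k))‖ 0.16) ≤ A k := by
    intro k
    refine max_le ?_ (max_le ?_ ?_)
    · exact (Real.le_sqrt (zero_le_logHeight₁ _) (by positivity)).mpr (by nlinarith [Real.pi_pos])
    · exact bms_norm_log_le_sqrt (bms_abs_log_norm_le_logHeight₁ σ (hα k))
    · linarith [hAπ k]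
  have hmain := bugeaudMignotteSiksek2006_thm_9_4_nf_of_matveev h K σ κ α b A B hα hΛ hbB hA
  rw [← hndef, ← hDdef] at hmain
  -- `n ≥ 1`, `B ≥ 1`
  have hb0 : ∃ k, b k ≠ 0 := by
    by_contra hall
    push Not at hall
    exact hΛ (by simp [hall])
  obtain ⟨k₁, hk₁⟩ := hb0
  have hn1 : 1 ≤ n := Fintype.card_pos_iff.mpr ⟨k₁⟩
  have hn0r : (0 : ℝ) < n := by exact_mod_cast hn1
  have hB1 : (1 : ℝ) ≤ B := le_trans (by exact_mod_cast Int.one_le_abs hk₁) (hbB k₁)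
  have hB0 : 0 < B := by linarith
  -- `log(en) + log B = 1 + log(nB)`, `log(eD) = 1 + log D`
  have hlogs : Real.log (E * n) + Real.log B = 1 + Real.log (n * B) := by
    rw [Real.log_mul hE0.ne' hn0r.ne', Real.log_mul hn0r.ne' hB0.ne', hEdef, Real.log_exp]; ring
  have hLD : Real.log (E * D) = 1 + Real.log D := by
    rw [Real.log_mul hE0.ne' hD0r.ne', hEdef, Real.log_exp]
  -- `D^{n+2} ∏ h'ⱼ = D² ∏ Aⱼ`
  have hk : ∀ k, Real.sqrt ((logHeight₁ (α k) / D) ^ 2 + Real.pi ^ 2 / (D : ℝ) ^ 2) = A k / D := by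
    intro k
    have h1 : (logHeight₁ (α k) / D) ^ 2 + Real.pi ^ 2 / (D : ℝ) ^ 2 =
        (logHeight₁ (α k) ^ 2 + Real.pi ^ 2) / (D : ℝ) ^ 2 := by
      rw [div_pow, add_div]
    rw [h1, Real.sqrt_div (by positivity), Real.sqrt_sq hD0r.le]
  have hprod : (D : ℝ) ^ (n + 2) *
      ∏ k, Real.sqrt ((logHeight₁ (α k) / D) ^ 2 + Real.pi ^ 2 / (D : ℝ) ^ 2) =
      (D : ℝ) ^ 2 * ∏ k, A k := by
    simp_rw [hk]
    rw [Finset.prod_div_distrib, Finset.prod_const, Finset.card_univ, ← hndef, pow_add]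
    field_simp
  -- the goal's constant is `2R`, `R` = the BMS bound
  set P : ℝ := ∏ k, A k with hPdef
  have hP0 : 0 < P := Finset.prod_pos fun k _ => hApos k
  set R : ℝ := 3 * 30 ^ (n + 4) * ((n : ℝ) + 1) ^ (11 / 2 : ℝ) *
      ((D : ℝ) ^ 2 * (1 + Real.log D)) * (1 + Real.log (n * B)) * P with hRdef
  have hR0 : 0 < R := by
    have h1 : 0 < 1 + Real.log D := by have := Real.log_nonneg hD1; linarith
    have h2 : 0 < 1 + Real.log (n * B) := by
      have := Real.log_nonneg (one_le_mul_of_one_le_of_one_le (by exact_mod_cast hn1 : (1:ℝ) ≤ n) hB1)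
      linarith
    rw [hRdef]
    exact mul_pos (mul_pos (mul_pos (by positivity) (mul_pos (by positivity) h1)) h2) hP0
  have hgoalL : 6 * 30 ^ (n + 4) * ((n : ℝ) + 1) ^ (11 / 2 : ℝ) * (D : ℝ) ^ (n + 2) *
      Real.log (E * D) *
      (∏ k, Real.sqrt ((logHeight₁ (α k) / D) ^ 2 + Real.pi ^ 2 / (D : ℝ) ^ 2)) *
      (Real.log (E * n) + Real.log B) = 2 * R := by
    rw [hlogs, hLD, hRdef]
    calc 6 * 30 ^ (n + 4) * ((n : ℝ) + 1) ^ (11 / 2 : ℝ) * (D : ℝ) ^ (n + 2) * (1 + Real.log D) *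
          (∏ k, Real.sqrt ((logHeight₁ (α k) / D) ^ 2 + Real.pi ^ 2 / (D : ℝ) ^ 2)) *
          (1 + Real.log (n * B))
        = 6 * 30 ^ (n + 4) * ((n : ℝ) + 1) ^ (11 / 2 : ℝ) * ((D : ℝ) ^ (n + 2) *
            ∏ k, Real.sqrt ((logHeight₁ (α k) / D) ^ 2 + Real.pi ^ 2 / (D : ℝ) ^ 2)) *
            (1 + Real.log D) * (1 + Real.log (n * B)) := by ring
      _ = 6 * 30 ^ (n + 4) * ((n : ℝ) + 1) ^ (11 / 2 : ℝ) * ((D : ℝ) ^ 2 * P) *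
            (1 + Real.log D) * (1 + Real.log (n * B)) := by rw [hprod]
      _ = 2 * (3 * 30 ^ (n + 4) * ((n : ℝ) + 1) ^ (11 / 2 : ℝ) *
            ((D : ℝ) ^ 2 * (1 + Real.log D)) * (1 + Real.log (n * B)) * P) := by ring
  rw [hgoalL, hwx, map_sub, map_one]
  -- `hmain : −R < log|Λ|`; `mult ∈ {1, 2}`
  have hmain' : -R < Real.log ‖σ (∏ k, α k ^ b k) - 1‖ := by rw [hRdef]; exact hmain
  have hmult : (w.mult : ℝ) = 1 ∨ (w.mult : ℝ) = 2 := by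
    rw [InfinitePlace.mult]; split_ifs <;> simp
  rcases hmult with hm | hm <;> rw [hm]
  · linarith only [hmain', hR0]
  · by_cases hpos : 0 ≤ Real.log ‖σ (∏ k, α k ^ b k) - 1‖
    · linarith only [hpos, hR0]
    · linarith only [hmain', hR0]

end Literature.NumberTheory.DiophantineGeometry.Dioph

end
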